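/-
COR-CM (cell pub-hodgecm2 = stage 2 of the Hodge ladder), seat b26 gen 17 (prover-pub-hodgecm2-b26-g17-0, 2026-08-21);
count-neutral for the binder table (no row).  EVERY complex elliptic curve has a period: its weight-one Hodge
structure `H¹_B` is isomorphic in `Hod_ℚ` to the structure `V¹_τ` of some `τ` in the upper half plane, so that the
period-conditional theorems of `Assembly/CMEllipticCurveOfPeriod[EndAlgebra]` and
`Assembly/EllipticCurvesOfPeriodsIsogenous` (gen 16) speak about all elliptic curves.  Theorems only: no
definition, no notation, no named fact, no instance.
-/
import Summits.HodgeConjecture.CorCM.Assembly.CMEllipticCurveOfPeriod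
import Summits.HodgeConjecture.CorCM.Geometry.WeightOneHodgeStructureOfPeriodIsogeny
import Literature.AlgebraicGeometry.HodgeTheory.WeightOneHodgeStructuresOfCurvesProofs
import Literature.AlgebraicGeometry.Motives.MixedHodgeStructure
import HarnessLib

/-!
# Every complex elliptic curve has a period

For a complex torus `E = ℂ/(ℤ + τℤ)` one has `H¹(E; ℚ) = ℚ²` with `H^{1,0} = ℂ (1, τ)` (Lange–Birkenhake §1.2,
Thm. 4.2.1); conversely every elliptic curve is such a torus for some `τ` with `Im τ > 0` (uniformisation,
Silverman AEC VI Thm. 5.1 / Cor. 5.1.1).  This file proves the HODGE-THEORETIC form of the latter statement for the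
tree's complex abelian varieties, with no uniformisation and no lattice: **for every complex abelian variety `A`
of dimension `1` and every Hodge symmetric Hodge model `B` of `A` there are `τ ∈ ℂ` with `Im τ > 0` and an
isomorphism in `Hod_ℚ` (a morphism of Hodge structures with bijective underlying `ℚ`-linear map) from
`H¹_B(A) = bettiOneHodgeStructure A B hB` to the weight-one Hodge structure `V¹_τ = ofSplitting (ℂ ∙ ω_τ) _ one_pos`
on `ℚ²`, `ω_τ = 1 ⊗ e₀ + τ ⊗ e₁`** (`exists_periodHom`; the structure `V¹_τ` is gen 15's
`Geometry/WeightOneHodgeStructureOfPeriod`).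

Proof.  (§1, linear algebra) A complex line `L ⊂ ℂ ⊗_ℚ ℚ² = ℂ²` with `L ⊕ L̄ = ℂ²` is `ℂ (1, τ)` for a unique
`τ ∉ ℝ`: a vector of `L` with first coordinate `0` is a multiple of its own conjugate, hence lies in `L ∩ L̄ = 0`;
normalising a non-zero vector of `L` to `ω = (1, τ)`, `τ ∈ ℝ` would give `ω̄ = ω ∈ L ∩ L̄`; and `L ⊆ ℂ ω` because
the `ω̄`-component of any `x ∈ L` lies in `L ∩ L̄` (`exists_period_of_isCompl`).  (§2, transport) For an EFFECTIVE
weight-one Hodge structure `H` on `W` (filtration `W_ℂ ⊇ F¹ ⊇ 0`, `weightOne_F_eq_bot_of_two_le` /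
`weightOne_F_eq_top_of_nonpos`) and a `ℚ`-linear isomorphism `φ : W ≅ V`, `φ` is a morphism of Hodge structures
`H → ofSplitting (φ_ℂ F¹)` (`exists_hom_ofSplitting_of_map_F_one`; the splitting `φ_ℂ F¹ ⊕ conj (φ_ℂ F¹) = V_ℂ` is
transported from `F¹ ⊕ F̄¹ = W_ℂ`, `isCompl_map_baseChange`).  (§3) `H¹_B(A)` is effective of weight one
(`isEffective_bettiOneHodgeStructure`) on `H¹(A(ℂ); ℚ)` of dimension `2 dim A = 2` (`finrank_bettiCohomology_one`);
a `ℚ`-basis gives `φ : H¹(A(ℂ); ℚ) ≅ ℚ²`, §1 gives `φ_ℂ F¹ = ℂ ω_τ` with `τ ∉ ℝ`, and if `Im τ < 0` one composes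
with gen 16's isomorphism `V¹_τ ≅ V¹_{-τ}` (`exists_hom_bijective_ratCast_mul`, the matrix `diag(1, -1)`).

Consequences for EVERY complex elliptic curve (the period hypothesis `H¹_B(A) ≅ V¹_τ` of gen 16 discharged) are
drawn in `Assembly/EllipticCurveEndomorphismAlgebra`; here only the headline dichotomy is recorded
(`isOfCMType_iff_not_hodgeEndTrivial_of_dim_eq_one`: Milne's «of CM type» agrees with Hodge-theoretic complex
multiplication on all elliptic curves).

HONEST SCOPE: classification of complex elliptic curves through Hodge theory (Moonen–Zarhin (2.1), `g = 1`);
nothing here bears on HC_CM or on the summit.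

References: [LangeBirkenhake1992] H. Lange, Ch. Birkenhake, *Complex Abelian Varieties*, §1.2, Thm. 4.2.1 ·
[SilvermanAEC2009] J. Silverman, *The Arithmetic of Elliptic Curves*, VI Thm. 5.1, Cor. 5.1.1 ·
[MoonenZarhin1999LowDim] B. Moonen, Yu. Zarhin, Math. Ann. 315 (1999), §2 (2.1) · [VoisinHodgeI2002] C. Voisin,
*Hodge Theory and Complex Algebraic Geometry I*, §7.1.1–7.1.2, §7.2.2 · [DeligneHodgeII1971] P. Deligne,
*Théorie de Hodge II*, 1.2.5, 2.3.5.
-/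

noncomputable section

open scoped TensorProduct
open CategoryTheory Module TensorProduct
open Literature.AlgebraicGeometry.Motives Literature.AlgebraicGeometry.HodgeTheory
open Literature.AlgebraicGeometry.Motives.HodgeStructure

/-! ## §1 A line `L ⊂ ℂ²` with `L ⊕ L̄ = ℂ²` is a period line `ℂ (1, τ)`, `τ ∉ ℝ` -/

namespace Summit.HodgeConjecture.CorCM.PeriodHodgeStructure

/-- In a splitting `L ⊕ L̄ = ℂ ⊗_ℚ ℚ²`, a vector of `L` whose coordinate `0` vanishes is zero: it is `(0, x₁)`, its
conjugate `(0, x̄₁)` is a complex multiple of it, so it lies in `L ∩ L̄ = 0`. [folklore] -/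
theorem eq_zero_of_mem_of_coord_zero_eq_zero {L : Submodule ℂ (ℂ ⊗[ℚ] (Fin 2 → ℚ))}
    (hL : IsCompl L (complexConj L)) {x : ℂ ⊗[ℚ] (Fin 2 → ℚ)} (hx : x ∈ L)
    (hx0 : piScalarRight ℚ ℂ ℂ (Fin 2) x 0 = 0) : x = 0 := by
  set x1 : ℂ := piScalarRight ℚ ℂ ℂ (Fin 2) x 1 with hx1
  by_cases h1 : x1 = 0
  · apply (piScalarRight ℚ ℂ ℂ (Fin 2)).injective
    rw [map_zero]
    funext i
    fin_cases i
    · exact hx0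
    · exact h1
  · -- `conj x = (x̄₁ / x₁) • x`, so `x ∈ L̄`
    have hconj : conj x = (starRingEnd ℂ x1 * x1⁻¹) • x := by
      apply (piScalarRight ℚ ℂ ℂ (Fin 2)).injective
      funext i
      rw [map_smul, Pi.smul_apply, smul_eq_mul, coords_conj]
      fin_cases i
      · change starRingEnd ℂ (piScalarRight ℚ ℂ ℂ (Fin 2) x 0) = _ * piScalarRight ℚ ℂ ℂ (Fin 2) x 0
        rw [hx0, map_zero, mul_zero]
      · change starRingEnd ℂ x1 = _ * x1
        rw [mul_assoc, inv_mul_cancel₀ h1, mul_one]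
    have hxc : x ∈ complexConj L := by
      rw [mem_complexConj, hconj]
      exact L.smul_mem _ hx
    have hbot : x ∈ L ⊓ complexConj L := ⟨hx, hxc⟩
    rwa [hL.inf_eq_bot, Submodule.mem_bot] at hbot

/-- `ℂ ⊗_ℚ ℚ²` is not zero: `1 ⊗ e₀ ≠ 0` (its coordinate `0` is `1`). [folklore] -/
theorem one_tmul_single_zero_ne_zero : (1 : ℂ) ⊗ₜ[ℚ] (Pi.single 0 1 : Fin 2 → ℚ) ≠ 0 := by
  intro h
  have h' := congrArg (fun y => piScalarRight ℚ ℂ ℂ (Fin 2) y 0) h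
  simp only [coords_tmul, map_zero, Pi.zero_apply] at h'
  simp at h'

/-- A summand of a splitting `L ⊕ L̄` of the non-zero space `ℂ ⊗_ℚ ℚ²` is non-zero (`L = 0` forces `L̄ = 0`).
[folklore] -/
theorem ne_bot_of_isCompl {L : Submodule ℂ (ℂ ⊗[ℚ] (Fin 2 → ℚ))} (hL : IsCompl L (complexConj L)) : L ≠ ⊥ := by
  intro h
  have htop := hL.sup_eq_top
  rw [h, complexConj_bot, bot_sup_eq] at htop
  have hmem : (1 : ℂ) ⊗ₜ[ℚ] (Pi.single 0 1 : Fin 2 → ℚ) ∈ (⊥ : Submodule ℂ (ℂ ⊗[ℚ] (Fin 2 → ℚ))) := by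
    rw [htop]; exact Submodule.mem_top
  exact one_tmul_single_zero_ne_zero ((Submodule.mem_bot ℂ).1 hmem)

/-- **A complex line of a splitting is a period line.**  If `L ⊂ ℂ ⊗_ℚ ℚ²` satisfies `L ⊕ L̄ = ℂ ⊗_ℚ ℚ²` then
`L = ℂ ω_τ` with `ω_τ = 1 ⊗ e₀ + τ ⊗ e₁` (coordinates `(1, τ)`) for some `τ ∈ ℂ ∖ ℝ`: normalise a non-zero vector of
`L` (its coordinate `0` is non-zero by `eq_zero_of_mem_of_coord_zero_eq_zero`); `τ ∈ ℝ` would make `ω̄_τ = ω_τ` a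
non-zero vector of `L ∩ L̄`; and the `ω̄`-component of any vector of `L` lies in `L ∩ L̄ = 0`.  (For `H¹` of the
torus `ℂ/(ℤ + τℤ)`: `H^{1,0} = ℂ (1, τ)`.) [cite: LangeBirkenhake1992, §1.2 and Thm. 4.2.1]
[cite: VoisinHodgeI2002, §7.2.2] -/
theorem exists_period_of_isCompl (L : Submodule ℂ (ℂ ⊗[ℚ] (Fin 2 → ℚ))) (hL : IsCompl L (complexConj L)) :
    ∃ τ : ℂ, τ.im ≠ 0 ∧ L = ℂ ∙ ((1 : ℂ) ⊗ₜ[ℚ] (Pi.single 0 1 : Fin 2 → ℚ) + τ ⊗ₜ[ℚ] Pi.single 1 1) := by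
  obtain ⟨v, hvL, hv0⟩ := Submodule.exists_mem_ne_zero_of_ne_bot (ne_bot_of_isCompl hL)
  set v0 : ℂ := piScalarRight ℚ ℂ ℂ (Fin 2) v 0 with hv0_def
  set v1 : ℂ := piScalarRight ℚ ℂ ℂ (Fin 2) v 1 with hv1_def
  have hv0ne : v0 ≠ 0 := fun h => hv0 (eq_zero_of_mem_of_coord_zero_eq_zero hL hvL h)
  -- the normalised vector `ω = v0⁻¹ • v` has coordinates `(1, τ)`, `τ = v0⁻¹ v1`
  set ω : ℂ ⊗[ℚ] (Fin 2 → ℚ) := v0⁻¹ • v with hω_def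
  set τ : ℂ := v0⁻¹ * v1 with hτ_def
  have hωL : ω ∈ L := L.smul_mem _ hvL
  have h0 : piScalarRight ℚ ℂ ℂ (Fin 2) ω 0 = 1 := by
    rw [hω_def, map_smul, Pi.smul_apply, smul_eq_mul, ← hv0_def, inv_mul_cancel₀ hv0ne]
  have h1 : piScalarRight ℚ ℂ ℂ (Fin 2) ω 1 = τ := by
    rw [hω_def, map_smul, Pi.smul_apply, smul_eq_mul, ← hv1_def]
  -- `τ ∉ ℝ`
  have hτ : τ.im ≠ 0 := by
    intro him
    have hconj : conj ω = ω := by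
      apply (piScalarRight ℚ ℂ ℂ (Fin 2)).injective
      funext i
      fin_cases i
      · change piScalarRight ℚ ℂ ℂ (Fin 2) (conj ω) 0 = piScalarRight ℚ ℂ ℂ (Fin 2) ω 0
        rw [coords_conj_zero h0, h0]
      · change piScalarRight ℚ ℂ ℂ (Fin 2) (conj ω) 1 = piScalarRight ℚ ℂ ℂ (Fin 2) ω 1
        rw [coords_conj_one h1, h1]
        exact Complex.conj_eq_iff_im.2 him
    have hωc : ω ∈ complexConj L := by rw [mem_complexConj, hconj]; exact hωL
    have hbot : ω ∈ L ⊓ complexConj L := ⟨hωL, hωc⟩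
    rw [hL.inf_eq_bot, Submodule.mem_bot] at hbot
    exact periodVector_ne_zero h0 hbot
  refine ⟨τ, hτ, ?_⟩
  rw [← eq_tmul_add_tmul h0 h1]
  apply le_antisymm
  · -- `L ⊆ ℂ ω`: the `ω̄`-component of `x ∈ L` lies in `L ∩ L̄ = 0`
    intro x hx
    obtain ⟨a, b, rfl⟩ := exists_eq_smul_add_smul_conj (isCompl_span h0 h1 hτ) x
    have hbL : b • conj ω ∈ L := by
      have h := L.sub_mem hx (L.smul_mem a hωL)
      rwa [add_sub_cancel_left] at h
    have hbc : b • conj ω ∈ complexConj L := by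
      rw [mem_complexConj, conj_smul, conj_conj]
      exact L.smul_mem _ hωL
    have hbot : b • conj ω ∈ L ⊓ complexConj L := ⟨hbL, hbc⟩
    rw [hL.inf_eq_bot, Submodule.mem_bot] at hbot
    rw [hbot, add_zero]
    exact Submodule.smul_mem _ a (Submodule.mem_span_singleton_self _)
  · rw [Submodule.span_singleton_le_iff_mem]
    exact hωL

end Summit.HodgeConjecture.CorCM.PeriodHodgeStructure

namespace Summit.HodgeConjecture.CorCM.PeriodCurve

/-! ## §2 Transport of an effective weight-one Hodge structure along a `ℚ`-linear isomorphism -/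

section Transport

universe u v

variable {W : Type u} [AddCommGroup W] [Module ℚ W] {V : Type v} [AddCommGroup V] [Module ℚ V]

/-- **A splitting `P ⊕ P̄ = W_ℂ` is transported by a `ℚ`-linear isomorphism `φ : W ≅ V`** to the splitting
`φ_ℂ P ⊕ conj (φ_ℂ P) = V_ℂ` (`conj` commutes with `φ_ℂ`, `MixedHodgeStructure.complexConj_map_baseChange`; `φ_ℂ` is a
`ℂ`-linear isomorphism, so `Submodule.map φ_ℂ` is a lattice isomorphism). [folklore] -/
theorem isCompl_map_baseChange (φ : W ≃ₗ[ℚ] V) {P : Submodule ℂ (ℂ ⊗[ℚ] W)} (hP : IsCompl P (complexConj P)) :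
    IsCompl (P.map (φ.toLinearMap.baseChange ℂ)) (complexConj (P.map (φ.toLinearMap.baseChange ℂ))) := by
  rw [MixedHodgeStructure.complexConj_map_baseChange]
  have key : ∀ Q : Submodule ℂ (ℂ ⊗[ℚ] W),
      Q.map (φ.toLinearMap.baseChange ℂ) = Submodule.orderIsoMapComap (φ.baseChange ℚ ℂ W V) Q := fun Q => rfl
  rw [key, key]
  exact hP.map _

/-- **A `ℚ`-linear isomorphism is a morphism of Hodge structures from an effective weight-one structure to the
two-type structure of the transported splitting.**  For `H` effective of weight one on `W` (filtration
`W_ℂ ⊇ F¹ ⊇ 0`), `φ : W ≅ V` and `L = φ_ℂ F¹` with `L ⊕ L̄ = V_ℂ`: `φ` underlies a morphism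
`H → ofSplitting L hP one_pos` (hence an isomorphism in `Hod_ℚ`). [cite: VoisinHodgeI2002, §7.2.2 (PDF p. 141)]
[cite: DeligneHodgeII1971, 1.2.5] -/
theorem exists_hom_ofSplitting_of_map_F_one (H : HodgeStructure W 1) (heff : H.IsEffective) (φ : W ≃ₗ[ℚ] V)
    (L : Submodule ℂ (ℂ ⊗[ℚ] V)) (hL : (H.F 1).map (φ.toLinearMap.baseChange ℂ) = L)
    (hP : IsCompl L (complexConj L)) :
    ∃ f : Hom H (ofSplitting L hP one_pos), f.toLinearMap = φ.toLinearMap := by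
  refine ⟨⟨φ.toLinearMap, fun p => ?_⟩, rfl⟩
  rw [ofSplitting_F]
  by_cases hp : p ≤ 0
  · rw [twoStepFiltration_of_le_zero _ hp]
    exact le_top
  by_cases hp1 : p = 1
  · subst hp1
    rw [twoStepFiltration_of_pos_of_le _ one_pos le_rfl, hL]
  · rw [weightOne_F_eq_bot_of_two_le H heff (by omega), Submodule.map_bot]
    exact bot_le

end Transport

/-! ## §3 Every complex elliptic curve has a period -/

section EllipticCurve

variable {A : AbelianVariety ℂ}

/-- **EVERY COMPLEX ELLIPTIC CURVE HAS A PERIOD.**  For a complex abelian variety `A` of dimension `1` and any Hodge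
symmetric Hodge model `B` of `A` there is `τ ∈ ℂ` with `Im τ > 0` such that, for every proof `hP` of the splitting
`ℂ ω_τ ⊕ ℂ ω̄_τ = ℂ²` (`ω_τ = 1 ⊗ e₀ + τ ⊗ e₁`; e.g. `PeriodHodgeStructure.isCompl_span`), the weight-one Hodge
structure `H¹_B(A)` is isomorphic in `Hod_ℚ` to `V¹_τ = ofSplitting (ℂ ∙ ω_τ) hP one_pos`: a morphism of Hodge
structures `H¹_B(A) → V¹_τ` with bijective underlying `ℚ`-linear map (its inverse is a morphism,
`Hom.symmOfBijective`).  Hodge-theoretic form of «every complex elliptic curve is `ℂ/(ℤ + τℤ)` with `Im τ > 0`».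
[cite: LangeBirkenhake1992, §1.2 and Thm. 4.2.1] [cite: SilvermanAEC2009, VI Thm. 5.1 and Cor. 5.1.1]
[cite: MoonenZarhin1999LowDim, §2 (2.1) (g = 1)] -/
theorem exists_periodHom (hA : A.dim = 1) (B : HodgeModel A.dim A.X) (hB : B.IsHodgeSymmetric) :
    ∃ τ : ℂ, 0 < τ.im ∧
      ∀ hP : IsCompl (ℂ ∙ ((1 : ℂ) ⊗ₜ[ℚ] (Pi.single 0 1 : Fin 2 → ℚ) + τ ⊗ₜ[ℚ] Pi.single 1 1))
          (complexConj (ℂ ∙ ((1 : ℂ) ⊗ₜ[ℚ] (Pi.single 0 1 : Fin 2 → ℚ) + τ ⊗ₜ[ℚ] Pi.single 1 1))),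
        ∃ f : Hom (bettiOneHodgeStructure A B hB)
            (ofSplitting (ℂ ∙ ((1 : ℂ) ⊗ₜ[ℚ] (Pi.single 0 1 : Fin 2 → ℚ) + τ ⊗ₜ[ℚ] Pi.single 1 1)) hP one_pos :
              HodgeStructure (Fin 2 → ℚ) 1),
          Function.Bijective f.toLinearMap := by
  haveI : Module.Finite ℚ (bettiCohomology A.X 1) := finite_bettiCohomology_one A
  have hrank : Module.finrank ℚ (bettiCohomology A.X 1) = 2 := by rw [finrank_bettiCohomology_one, hA]
  -- a `ℚ`-basis of `H¹(A(ℂ); ℚ)` and the transported line `L = φ_ℂ F¹`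
  let φ : bettiCohomology A.X 1 ≃ₗ[ℚ] (Fin 2 → ℚ) := (Module.finBasisOfFinrankEq ℚ _ hrank).equivFun
  set H := bettiOneHodgeStructure A B hB with hH
  have heff : H.IsEffective := isEffective_bettiOneHodgeStructure A B hB
  set L : Submodule ℂ (ℂ ⊗[ℚ] (Fin 2 → ℚ)) := (H.F 1).map (φ.toLinearMap.baseChange ℂ) with hL_def
  have hPL : IsCompl L (complexConj L) := isCompl_map_baseChange φ (H.isCompl_F_complexConj 1 1 (by norm_num))
  obtain ⟨τ₀, hτ₀, hL⟩ := PeriodHodgeStructure.exists_period_of_isCompl L hPL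
  obtain ⟨h0, h1⟩ := coords_periodVector τ₀
  have hP₀ := PeriodHodgeStructure.isCompl_span h0 h1 hτ₀
  obtain ⟨f₀, hf₀⟩ := exists_hom_ofSplitting_of_map_F_one H heff φ _ hL hP₀
  have hbij₀ : Function.Bijective f₀.toLinearMap := by rw [hf₀]; exact φ.bijective
  rcases lt_or_gt_of_ne hτ₀ with hneg | hpos
  · -- `Im τ₀ < 0`: compose with `V¹_{τ₀} ≅ V¹_{-τ₀}` (the matrix `diag(1, -1)`)
    refine ⟨-τ₀, by simpa using hneg, fun hP => ?_⟩
    obtain ⟨h0', h1'⟩ := coords_periodVector (-τ₀)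
    obtain ⟨S, hS⟩ := PeriodHodgeStructure.exists_hom_bijective_ratCast_mul h0 h1 h0' h1' hP₀ hP hτ₀ (-1)
      (by push_cast; ring)
    exact ⟨S.comp f₀, hS.comp hbij₀⟩
  · exact ⟨τ₀, hpos, fun hP => ⟨f₀, hbij₀⟩⟩

/-- **Every complex elliptic curve has a period (canonical splitting proof).**  Same statement with the splitting
proof `PeriodHodgeStructure.isCompl_span` of gen 15 displayed, ready for the period-conditional theorems of
`Assembly/CMEllipticCurveOfPeriod[EndAlgebra]` / `Assembly/EllipticCurvesOfPeriodsIsogenous`.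
[cite: LangeBirkenhake1992, §1.2 and Thm. 4.2.1] [cite: SilvermanAEC2009, VI Thm. 5.1 and Cor. 5.1.1] -/
theorem exists_periodHom' (hA : A.dim = 1) (B : HodgeModel A.dim A.X) (hB : B.IsHodgeSymmetric) :
    ∃ (τ : ℂ) (hτ : 0 < τ.im) (f : Hom (bettiOneHodgeStructure A B hB)
        (ofSplitting (ℂ ∙ ((1 : ℂ) ⊗ₜ[ℚ] (Pi.single 0 1 : Fin 2 → ℚ) + τ ⊗ₜ[ℚ] Pi.single 1 1))
          (PeriodHodgeStructure.isCompl_span (coords_periodVector τ).1 (coords_periodVector τ).2 hτ.ne') one_pos :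
            HodgeStructure (Fin 2 → ℚ) 1)),
      Function.Bijective f.toLinearMap := by
  obtain ⟨τ, hτ, h⟩ := exists_periodHom hA B hB
  obtain ⟨f, hf⟩ := h (PeriodHodgeStructure.isCompl_span (coords_periodVector τ).1 (coords_periodVector τ).2 hτ.ne')
  exact ⟨τ, hτ, f, hf⟩

/-- **Every complex elliptic curve has a period, model-free form**: for `A` of dimension `1` there are a Hodge
symmetric Hodge model `B` (real models exist, `exists_isReal_hodgeModel_holds`), `τ` with `Im τ > 0` and an
isomorphism `H¹_B(A) ≅ V¹_τ` in `Hod_ℚ`. [cite: LangeBirkenhake1992, §1.2 and Thm. 4.2.1]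
[cite: SilvermanAEC2009, VI Thm. 5.1 and Cor. 5.1.1] -/
theorem exists_model_periodHom (hA : A.dim = 1) :
    ∃ (B : HodgeModel A.dim A.X) (hB : B.IsHodgeSymmetric) (τ : ℂ) (hτ : 0 < τ.im)
      (f : Hom (bettiOneHodgeStructure A B hB)
        (ofSplitting (ℂ ∙ ((1 : ℂ) ⊗ₜ[ℚ] (Pi.single 0 1 : Fin 2 → ℚ) + τ ⊗ₜ[ℚ] Pi.single 1 1))
          (PeriodHodgeStructure.isCompl_span (coords_periodVector τ).1 (coords_periodVector τ).2 hτ.ne') one_pos :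
            HodgeStructure (Fin 2 → ℚ) 1)),
      Function.Bijective f.toLinearMap := by
  obtain ⟨B, hB⟩ := exists_isReal_hodgeModel_holds.exists_isHodgeSymmetric
    (AbelianVariety.isSmoothProjective_holds (A := A))
  obtain ⟨τ, hτ, f, hf⟩ := exists_periodHom' hA B hB
  exact ⟨B, hB, τ, hτ, f, hf⟩

/-! ## §4 First consequence for every elliptic curve: CM type iff Hodge-theoretic complex multiplication -/

/-- **On EVERY complex elliptic curve, Milne's «of CM type» is Hodge-theoretic complex multiplication**:
for every complex abelian variety `A` of dimension `1`, `Milne1999.IsOfCMType A ↔ ¬ EllipticCurve.HodgeEndTrivial A`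
(gen 16's `isOfCMType_iff_not_hodgeEndTrivial` for curves with a period structure, now unconditional by
`exists_periodHom`: both sides say that the period is imaginary quadratic — Moonen–Zarhin (2.1), `g = 1`, Type
IV(1,1) versus Type I(1)). [cite: MoonenZarhin1999LowDim, §2 (2.1) (g = 1)] [cite: Milne1999, §2 p. 54]
[cite: DeligneMilne1982Tannakian, art. II §6 Thm. 6.20 (Riemann), LNM 900 p. 212] -/
theorem isOfCMType_iff_not_hodgeEndTrivial_of_dim_eq_one (hA : A.dim = 1) :
    Literature.AlgebraicGeometry.Milne1999.IsOfCMType A ↔ ¬ EllipticCurve.HodgeEndTrivial A := by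
  obtain ⟨B, hB, τ, hτ, f, hf⟩ := exists_model_periodHom hA
  exact isOfCMType_iff_not_hodgeEndTrivial (coords_periodVector τ).1 (coords_periodVector τ).2 _ f hf hτ.ne'

/-- **The period of an elliptic curve decides its CM type**: for `A` of dimension `1` there is `τ` with `Im τ > 0`,
`H¹_B(A) ≅ V¹_τ` for some Hodge symmetric model, and `IsOfCMType A ↔ τ` satisfies a rational quadratic equation,
`HodgeEndTrivial A ↔` it does not. [cite: MoonenZarhin1999LowDim, §2 (2.1) (g = 1)] [cite: SilvermanAEC2009, VI Thm. 5.5] -/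
theorem exists_period_isOfCMType_iff (hA : A.dim = 1) :
    ∃ τ : ℂ, 0 < τ.im ∧
      (∃ (B : HodgeModel A.dim A.X) (hB : B.IsHodgeSymmetric) (H : HodgeStructure (Fin 2 → ℚ) 1)
        (f : Hom (bettiOneHodgeStructure A B hB) H), Function.Bijective f.toLinearMap ∧
          H.F 1 = ℂ ∙ ((1 : ℂ) ⊗ₜ[ℚ] (Pi.single 0 1 : Fin 2 → ℚ) + τ ⊗ₜ[ℚ] Pi.single 1 1)) ∧
      (Literature.AlgebraicGeometry.Milne1999.IsOfCMType A ↔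
          ∃ a b c : ℚ, a ≠ 0 ∧ (a : ℂ) * τ ^ 2 + b * τ + c = 0) ∧
      (EllipticCurve.HodgeEndTrivial A ↔ ¬ ∃ a b c : ℚ, a ≠ 0 ∧ (a : ℂ) * τ ^ 2 + b * τ + c = 0) := by
  obtain ⟨B, hB, τ, hτ, f, hf⟩ := exists_model_periodHom hA
  obtain ⟨h0, h1⟩ := coords_periodVector τ
  have hP := PeriodHodgeStructure.isCompl_span h0 h1 hτ.ne'
  exact ⟨τ, hτ, ⟨B, hB, _, f, hf, PeriodHodgeStructure.F_one hP⟩, isOfCMType_iff h0 h1 hP f hf hτ.ne',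
    hodgeEndTrivial_iff h0 h1 hP f hf hτ.ne'⟩

end EllipticCurve

end Summit.HodgeConjecture.CorCM.PeriodCurve

end
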